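import Summits.NavierStokesRegularity.NavierStokesRegularity.Theorems.PerpetualPumpAveragedTypeIBlowupPulseTools

/-!
# Crux `PerpetualPump.AveragedTypeIBlowup` (stmt-NavierStokesRegularity-1835), line `Sketch`:
# tools for the stub `pulse` — clock-coordinate algebra

Pointwise real algebra for the proof of the registered stub `stub_pulse` (the TRANSFER PULSE of the
forced Toda gate), in the clock coordinates `P = b + β`, `R = √((b-β)² + 2w²)`, `u = (b-β)/R`
(`b - β = uR`, `2w² = R²(1-u²)`, `X = (P-R)/2 = J/(P+R)`), `B ≥ 10⁴`, `q⁴ ∈ [1, 1.11]`: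

* `pulse_alg_atT` — the state when the bond has decayed to `w = 1` with `R ≥ 0.99 B` and the clock
  below its barrier: `1 + u = O(B⁻²)`, so `u ≤ 0`, `b ≤ 83/5000`, `β ≥ (P+R)/2 - 10⁻⁴`.
* `pulse_alg_late` — the state when `1 + u ≤ 0.5002/B`: `β' = -q⁴β + w² + f₃ < 0` and
  `b - β - 1 ≤ -49B/50`.
* `pulse_budget` — the time budget `(8 log 2 + 3 log B)/(49B/50) ≤ (5 log B + 20)/B`.
* `pulse_alg_location_aux`, `pulse_alg_location` (= registered sub-goal `stub_pulseAlgebra`) —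
  at the argmax of `β` (Fermat: `w² = q⁴β - f₃`), with `J = L - (q⁴-1)β`, `L ∈ [-(B/20+1/100),
  27B/500]`, `β ≥ 0.996 B`: `P + R ≥ 1.992 B`, `|R(1+u) - q⁴| ≤ 2·10⁻⁵` (two passes through the
  Fermat relation `(R(1+u) - q⁴) R (1-u)/2 = q⁴X - f₃`), hence
  `b - 1/2 = (L + (q⁴-1)R(1+u)/2)/(P+R) + (R(1+u) - q⁴)/2 ∈ [-0.026, 0.028]`.

## References

Folklore; the gate is the Toda-type transfer step of T. Tao, *Finite time blowup for an averaged
three-dimensional Navier–Stokes equation*, J. Amer. Math. Soc. 29 (2016), 601–674, §5.4–5.5.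
-/

noncomputable section

-- the summit namespace `…NavierStokesRegularity.NavierStokesRegularity…` is the tree convention
set_option linter.dupNamespace false

open Set

namespace Summit.NavierStokesRegularity.NavierStokesRegularity.Theorems.PerpetualPumpAveragedTypeIBlowup

/-- at T -/
theorem pulse_alg_atT {b β R u B : ℝ} (hB : 10 ^ 4 ≤ B)
    (hR1 : 99 / 100 * B ≤ R) (hR2 : R ≤ 1001 / 1000 * B)
    (hw2 : 2 * (1:ℝ) ^ 2 = R ^ 2 * (1 - u ^ 2)) (hu1 : -1 ≤ u) (hubar : u ≤ 1 - 1 / (202 * B))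
    (hX : (b + β - R) / 2 ≤ 33 / 2000) (hD : b - β = u * R) :
    u ≤ 0 ∧ b ≤ 83 / 5000 ∧ (b + β + R) / 2 - 1 / 10000 ≤ β := by
  have hB0 : 0 < B := lt_of_lt_of_le (by norm_num) hB
  have hR0 : 0 < R := by linarith
  obtain ⟨v, hv⟩ : ∃ v : ℝ, v = 1 + u := ⟨_, rfl⟩
  have hv0 : 0 ≤ v := by linarith
  have hgap : 1 / (202 * B) ≤ 2 - v := by linarith
  have hkey : v * (2 - v) * R ^ 2 = 2 := by
    have : 1 - u ^ 2 = v * (2 - v) := by rw [hv]; ring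
    nlinarith
  -- step 1: `v R² ≤ 404 B`
  have h1 : v * R ^ 2 ≤ 404 * B := by
    have h : v * R ^ 2 * (1 / (202 * B)) ≤ v * R ^ 2 * (2 - v) :=
      mul_le_mul_of_nonneg_left hgap (by positivity)
    have e : v * R ^ 2 * (2 - v) = 2 := by linarith [hkey]
    rw [e] at h
    have h' : v * R ^ 2 ≤ 2 * (202 * B) := by
      have := mul_le_mul_of_nonneg_right h (show (0:ℝ) ≤ 202 * B by positivity)
      field_simp at this
      linarith
    linarith
  -- step 2: `v ≤ 1/20`, so `2 - v ≥ 39/20`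
  have h2 : v ≤ 1 / 20 := by
    have hR2' : (99 / 100 * B) ^ 2 ≤ R ^ 2 := pow_le_pow_left₀ (by positivity) hR1 2
    have : v * (99 / 100 * B) ^ 2 ≤ 404 * B := le_trans (mul_le_mul_of_nonneg_left hR2' hv0) h1
    nlinarith
  -- step 3: `v R² ≤ 40/39`
  have h3 : v * R ^ 2 ≤ 40 / 39 := by nlinarith [mul_le_mul_of_nonneg_left (show 39 / 20 ≤ 2 - v by linarith) (by positivity : 0 ≤ v * R ^ 2)]
  -- step 4: `v R ≤ (40/39)/R ≤ 2/B`, `R v / 2 ≤ 1/10000`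
  have h4 : v * R * R ≤ 40 / 39 := by nlinarith
  have h5 : v * R ≤ 1 / (5000 * B) * R := by
    have : 40 / 39 ≤ 1 / (5000 * B) * R * R := by
      have e : 1 / (5000 * B) * R * R = R * R / (5000 * B) := by ring
      rw [e, le_div_iff₀ (by positivity)]
      nlinarith
    nlinarith
  have h6 : v * R ≤ 1 / (5000 * B) * R := h5
  have h7 : v * R ≤ 1 / 4995 := by
    have : 1 / (5000 * B) * R ≤ 1 / (5000 * B) * (1001 / 1000 * B) :=
      mul_le_mul_of_nonneg_left hR2 (by positivity)
    have e : 1 / (5000 * B) * (1001 / 1000 * B) = 1001 / 5000000 := by field_simp; ring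
    linarith
  have hb : b = (b + β - R) / 2 + R * v / 2 := by rw [hv]; linarith
  have hβ : β = (b + β + R) / 2 - R * v / 2 := by rw [hv]; linarith
  refine ⟨?_, ?_, ?_⟩
  · -- u ≤ 0 from v ≤ 1/20
    linarith
  · rw [hb]; nlinarith
  · rw [hβ]; nlinarith

/-- late -/
theorem pulse_alg_late {b β w R u q4 f₃ B : ℝ} (hB : 10 ^ 4 ≤ B) (hq1 : 1 ≤ q4)
    (hf₃ : f₃ ≤ 1 / 2000) (hR1 : 99 / 100 * B ≤ R) (hR2 : R ≤ 1001 / 1000 * B)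
    (hD : b - β = u * R) (hw2 : 2 * w ^ 2 = R ^ 2 * (1 - u ^ 2))
    (hX : -(43 / 500) ≤ (b + β - R) / 2) (hu1 : -1 ≤ u) (hv : 1 + u ≤ 5002 / 10000 / B) :
    -(q4 * β) + w ^ 2 + f₃ < 0 ∧ b - β - 1 ≤ -(49 * B / 50) := by
  have hB0 : 0 < B := lt_of_lt_of_le (by norm_num) hB
  have hR0 : 0 < R := by linarith
  obtain ⟨v, hv'⟩ : ∃ v : ℝ, v = 1 + u := ⟨_, rfl⟩
  have hv0 : 0 ≤ v := by linarith
  have hRv_eq : R * v = R + (b - β) := by rw [hv', hD]; ring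
  have hRv : R * v ≤ 5008 / 10000 := by
    have h1 : R * v ≤ R * (5002 / 10000 / B) := by rw [hv']; exact mul_le_mul_of_nonneg_left hv hR0.le
    have h2 : R * (5002 / 10000 / B) ≤ 1001 / 1000 * B * (5002 / 10000 / B) :=
      mul_le_mul_of_nonneg_right hR2 (by positivity)
    have e : 1001 / 1000 * B * (5002 / 10000 / B) = 1001 * 5002 / 10000000 := by
      field_simp
      norm_num
    linarith
  have hβ : β = (b + β - R) / 2 + R - R * v / 2 := by linarith
  have hw : w ^ 2 = R ^ 2 * v * (2 - v) / 2 := by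
    have : R ^ 2 * (1 - u ^ 2) = R ^ 2 * v * (2 - v) := by rw [hv']; ring
    linarith
  have hw' : w ^ 2 ≤ R * (R * v) := by
    rw [hw]
    linarith [mul_nonneg (mul_nonneg hR0.le hR0.le) (mul_nonneg hv0 hv0)]
  constructor
  · have hβpos : 0 ≤ β := by rw [hβ]; linarith
    have h1 : -(q4 * β) ≤ -β := by linarith [mul_nonneg (sub_nonneg.2 hq1) hβpos]
    have h2 : R * (R * v) ≤ R * (5008 / 10000) := mul_le_mul_of_nonneg_left hRv hR0.le
    have h3 : β ≥ R - 43 / 500 - 5008 / 10000 / 2 := by linarith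
    linarith
  · linarith


/-- **The time budget.** `t₁ + t₂ + t₃ = (8 log 2 + 3 log B)/(49B/50) ≤ (5 log B + 20)/B` for
`B ≥ 10⁴` (indeed `400 log 2 ≤ 95 log B + 980`). [folklore] -/
theorem pulse_budget {B : ℝ} (hB : 10 ^ 4 ≤ B) :
    0 ≤ Real.log (128 * B) / (49 * B / 50) ∧ 0 ≤ Real.log (2 * B) / (49 * B / 50) ∧
    0 ≤ Real.log B / (49 * B / 50) ∧
    Real.log (128 * B) / (49 * B / 50) + Real.log (2 * B) / (49 * B / 50) +
      Real.log B / (49 * B / 50) ≤ (5 * Real.log B + 20) / B := by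
  have hB0 : 0 < B := lt_of_lt_of_le (by norm_num) hB
  have hK0 : (0 : ℝ) < 49 * B / 50 := by positivity
  have hlogB : 0 ≤ Real.log B := Real.log_nonneg (by linarith)
  refine ⟨div_nonneg (Real.log_nonneg (by linarith)) hK0.le,
    div_nonneg (Real.log_nonneg (by linarith)) hK0.le, div_nonneg hlogB hK0.le, ?_⟩
  have hlog128 : Real.log (128 * B) = 7 * Real.log 2 + Real.log B := by
    rw [Real.log_mul (by norm_num) hB0.ne', show (128 : ℝ) = 2 ^ 7 by norm_num, Real.log_pow]
    push_cast
    ring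
  have hlog2B : Real.log (2 * B) = Real.log 2 + Real.log B := Real.log_mul (by norm_num) hB0.ne'
  rw [hlog128, hlog2B, ← add_div, ← add_div, div_le_div_iff₀ hK0 hB0]
  have h2 := Real.log_two_lt_d9
  nlinarith [mul_nonneg hB0.le hlogB]

/-- location aux -/
theorem pulse_alg_location_aux {b β w R u q4 f₃ L B : ℝ} (hB : 10 ^ 4 ≤ B) (hq1 : 1 ≤ q4)
    (hq2 : q4 ≤ 111 / 100) (hf₃ : |f₃| ≤ 1 / 2000) (hR1 : 99 / 100 * B ≤ R)
    (hD : b - β = u * R) (hw2 : 2 * w ^ 2 = R ^ 2 * (1 - u ^ 2))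
    (hu1 : -1 ≤ u) (hubar : u ≤ 1 - 1 / (202 * B))
    (hβlo : 996 / 1000 * B ≤ β) (hβhi : β ≤ B + 1 / 100)
    (hLlo : -(B / 20 + 1 / 100) ≤ L) (hLhi : L ≤ 27 * B / 500)
    (hL : 2 * b * β - w ^ 2 + (q4 - 1) * β = L) (hF : -(q4 * β) + w ^ 2 + f₃ = 0) :
    1992 / 1000 * B ≤ b + β + R ∧ (b + β - R) / 2 * (b + β + R) = L - (q4 - 1) * β ∧
      |R * (1 + u) - q4| ≤ 1 / 50000 := by
  have hB0 : 0 < B := lt_of_lt_of_le (by norm_num) hB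
  have hR0 : 0 < R := by linarith
  have hf := abs_le.1 hf₃
  obtain ⟨v, hv'⟩ : ∃ v : ℝ, v = 1 + u := ⟨_, rfl⟩
  have hv0 : 0 ≤ v := by linarith
  have hgap : 1 / (202 * B) ≤ 2 - v := by linarith
  obtain ⟨X, hX'⟩ : ∃ X : ℝ, X = (b + β - R) / 2 := ⟨_, rfl⟩
  obtain ⟨S, hS'⟩ : ∃ S : ℝ, S = b + β + R := ⟨_, rfl⟩
  have hRv_eq : R * v = R + (b - β) := by rw [hv', hD]; ring
  have hβ : β = X + R - R * v / 2 := by rw [hX']; linarith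
  have hR2 : R ^ 2 = (b - β) ^ 2 + 2 * w ^ 2 := by
    have : (b - β) ^ 2 = u ^ 2 * R ^ 2 := by rw [hD]; ring
    linarith
  have hw : w ^ 2 = R ^ 2 * v * (2 - v) / 2 := by
    have : R ^ 2 * (1 - u ^ 2) = R ^ 2 * v * (2 - v) := by rw [hv']; ring
    linarith
  -- `X S = J = L - (q⁴ - 1) β`
  have hJ : X * S = L - (q4 - 1) * β := by
    have e : X * S = ((b + β) ^ 2 - R ^ 2) / 2 := by rw [hX', hS']; ring
    rw [e, hR2, ← hL]; ring
  have hSβ : S = 2 * β + R * v := by rw [hS']; linarith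
  have hS0 : 1992 / 1000 * B ≤ S := by rw [hSβ]; linarith [mul_nonneg hR0.le hv0]
  have hSpos : 0 < S := by linarith
  -- bounds for `X = (L - (q⁴-1)β)/S`
  have hqβ1 : (q4 - 1) * β ≤ 11 / 100 * (B + 1 / 100) := by
    have h1 : (q4 - 1) * β ≤ (q4 - 1) * (B + 1 / 100) := mul_le_mul_of_nonneg_left hβhi (by linarith)
    have h2 : (q4 - 1) * (B + 1 / 100) ≤ 11 / 100 * (B + 1 / 100) :=
      mul_le_mul_of_nonneg_right (by linarith) (by linarith)
    linarith
  have hqβ0 : 0 ≤ (q4 - 1) * β := mul_nonneg (by linarith) (by linarith)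
  have hXlo : -(81 / 1000) ≤ X := by
    by_contra! h
    have h1 : X * S < -(81 / 1000) * S := mul_lt_mul_of_pos_right h hSpos
    linarith
  have hXhi : X ≤ 28 / 1000 := by
    by_contra! h
    have h1 : 28 / 1000 * S < X * S := mul_lt_mul_of_pos_right h hSpos
    linarith
  -- the Fermat relation: `(R v - q⁴) R (2 - v) / 2 = q⁴ X - f₃ =: E`, `|E| ≤ 0.091`
  have hFermat : (R * v - q4) * (R * (2 - v)) / 2 = q4 * X - f₃ := by
    have e : (R * v - q4) * (R * (2 - v)) / 2 = R ^ 2 * v * (2 - v) / 2 - q4 * (R - R * v / 2) := by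
      ring
    have hqβ : q4 * β = q4 * X + q4 * (R - R * v / 2) := by rw [hβ]; ring
    rw [e, ← hw]
    linarith
  have hE : |q4 * X - f₃| ≤ 91 / 1000 := by
    have h1 : 0 ≤ q4 * (X + 81 / 1000) := mul_nonneg (by linarith) (by linarith)
    have h2 : 0 ≤ q4 * (28 / 1000 - X) := mul_nonneg (by linarith) (by linarith)
    rw [abs_le]
    constructor <;> linarith
  -- first pass: `R v ≤ 40`
  have hRv1 : R * v ≤ 40 := by
    by_contra! h
    have h1 : 99 / 100 / 202 ≤ R * (2 - v) := by
      have := mul_le_mul hR1 hgap (by positivity) hR0.le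
      have e : 99 / 100 * B * (1 / (202 * B)) = 99 / 100 / 202 := by
        field_simp
      linarith
    have h2 : 3889 / 100 * (99 / 100 / 202) ≤ (R * v - q4) * (R * (2 - v)) :=
      mul_le_mul (by linarith) h1 (by norm_num) (by linarith)
    linarith [(abs_le.1 hE).2, hFermat]
  -- so `2 - v ≥ 199/100`
  have hv2 : 199 / 100 ≤ 2 - v := by
    have h1 : v * (99 / 100 * B) ≤ v * R := mul_le_mul_of_nonneg_left hR1 hv0
    have h3 : v * 9900 ≤ v * (99 / 100 * B) := mul_le_mul_of_nonneg_left (by linarith) hv0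
    linarith
  -- second pass: `|R v - q⁴| ≤ 1/50000`
  have key : |R * v - q4| * (R * (2 - v)) / 2 ≤ 91 / 1000 := by
    have e : |R * v - q4| * (R * (2 - v)) / 2 = |(R * v - q4) * (R * (2 - v)) / 2| := by
      rw [abs_div, abs_mul, abs_of_nonneg (by positivity : 0 ≤ R * (2 - v)), abs_two]
    rw [e, hFermat]
    exact hE
  have hprod : 99 / 100 * B * (199 / 100) ≤ R * (2 - v) :=
    mul_le_mul hR1 hv2 (by norm_num) hR0.le
  have h3 : |R * v - q4| * (99 / 100 * B * (199 / 100)) ≤ |R * v - q4| * (R * (2 - v)) :=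
    mul_le_mul_of_nonneg_left hprod (abs_nonneg _)
  refine ⟨by rw [← hS']; exact hS0, by rw [← hX', ← hS']; exact hJ, ?_⟩
  rw [← hv']
  by_contra! h
  have h4 : 1 / 50000 * (99 / 100 * B * (199 / 100)) <
      |R * v - q4| * (99 / 100 * B * (199 / 100)) :=
    mul_lt_mul_of_pos_right h (by positivity)
  linarith

/-- location -/
theorem pulse_alg_location {b β w R u q4 f₃ L B : ℝ} (hB : 10 ^ 4 ≤ B) (hq1 : 1 ≤ q4)
    (hq2 : q4 ≤ 111 / 100) (hf₃ : |f₃| ≤ 1 / 2000) (hR1 : 99 / 100 * B ≤ R)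
    (hD : b - β = u * R) (hw2 : 2 * w ^ 2 = R ^ 2 * (1 - u ^ 2))
    (hu1 : -1 ≤ u) (hubar : u ≤ 1 - 1 / (202 * B))
    (hβlo : 996 / 1000 * B ≤ β) (hβhi : β ≤ B + 1 / 100)
    (hLlo : -(B / 20 + 1 / 100) ≤ L) (hLhi : L ≤ 27 * B / 500)
    (hL : 2 * b * β - w ^ 2 + (q4 - 1) * β = L) (hF : -(q4 * β) + w ^ 2 + f₃ = 0) :
    |b - 1 / 2| ≤ 1 / 20 := by
  obtain ⟨hS0, hJ, hRv⟩ := pulse_alg_location_aux hB hq1 hq2 hf₃ hR1 hD hw2 hu1 hubar hβlo hβhi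
    hLlo hLhi hL hF
  have hB0 : 0 < B := lt_of_lt_of_le (by norm_num) hB
  have hR0 : 0 < R := by linarith
  obtain ⟨v, hv'⟩ : ∃ v : ℝ, v = 1 + u := ⟨_, rfl⟩
  have hv0 : 0 ≤ v := by linarith
  obtain ⟨S, hS'⟩ : ∃ S : ℝ, S = b + β + R := ⟨_, rfl⟩
  rw [← hv'] at hRv
  rw [← hS'] at hS0 hJ
  have hSpos : 0 < S := by linarith
  have hRv_eq : R * v = R + (b - β) := by rw [hv', hD]; ring
  have hb : b = (b + β - R) / 2 + R * v / 2 := by linarith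
  have hβe : β = (S - R * v) / 2 := by rw [hS']; linarith
  -- `b - 1/2 = (L + (q⁴-1) R v / 2)/S + (R v - q⁴)/2`
  have hb' : b - 1 / 2 = (L + (q4 - 1) * (R * v) / 2) / S + (R * v - q4) / 2 := by
    have h1 : (b - 1 / 2) * S = (L + (q4 - 1) * (R * v) / 2) + (R * v - q4) / 2 * S := by
      have : b * S = (b + β - R) / 2 * S + R * v / 2 * S := by
        nth_rewrite 1 [hb]
        ring
      rw [sub_mul, this, hJ, hβe]
      ring
    field_simp
    linarith
  rw [hb']
  have hRvq := abs_le.1 hRv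
  have hRv0 : 0 ≤ R * v := mul_nonneg hR0.le hv0
  have hqRv : 0 ≤ (q4 - 1) * (R * v) := mul_nonneg (by linarith) hRv0
  have hqRv' : (q4 - 1) * (R * v) ≤ 11 / 100 * 2 := by
    have := mul_le_mul (show q4 - 1 ≤ 11 / 100 by linarith) (show R * v ≤ 2 by linarith)
      hRv0 (by norm_num)
    linarith
  have hT1 : (L + (q4 - 1) * (R * v) / 2) / S ≤ 272 / 10000 := by
    rw [div_le_iff₀ hSpos]
    linarith
  have hT2 : -(252 / 10000) ≤ (L + (q4 - 1) * (R * v) / 2) / S := by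
    rw [le_div_iff₀ hSpos]
    linarith
  rw [abs_le]
  constructor <;> linarith

/-- **Registered sub-goal `stub_pulseAlgebra` of the stub `pulse`** (closed form of
`pulse_alg_location`): the old carrier sits at `1/2 ± 1/20` at the argmax of `β`. [folklore] -/
theorem stub_pulseAlgebra :
    ∀ {b β w R u q4 f₃ L B : ℝ},
      10 ^ 4 ≤ B → 1 ≤ q4 → q4 ≤ 111 / 100 → |f₃| ≤ 1 / 2000 → 99 / 100 * B ≤ R → b - β = u * R →
      2 * w ^ 2 = R ^ 2 * (1 - u ^ 2) → -1 ≤ u → u ≤ 1 - 1 / (202 * B) → 996 / 1000 * B ≤ β →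
      β ≤ B + 1 / 100 → -(B / 20 + 1 / 100) ≤ L → L ≤ 27 * B / 500 →
      2 * b * β - w ^ 2 + (q4 - 1) * β = L → -(q4 * β) + w ^ 2 + f₃ = 0 →
      |b - 1 / 2| ≤ 1 / 20  :=
  fun hB hq1 hq2 hf₃ hR1 hD hw2 hu1 hubar hβlo hβhi hLlo hLhi hL hF =>
    pulse_alg_location hB hq1 hq2 hf₃ hR1 hD hw2 hu1 hubar hβlo hβhi hLlo hLhi hL hF

end Summit.NavierStokesRegularity.NavierStokesRegularity.Theorems.PerpetualPumpAveragedTypeIBlowup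

end
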